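import Summits.ResolutionOfSingularities.ResolutionOfSingularities.Theorems.WeightedInvariantIotaOrderHusc
import Summits.ResolutionOfSingularities.ResolutionOfSingularities.Theorems.WeightedInvariantStratumIffModels
import Summits.ResolutionOfSingularities.ResolutionOfSingularities.Theorems.WeightedInvariantHypersurfaceLocalGameEFT4SDimLETwo
import Summits.ResolutionOfSingularities.ResolutionOfSingularities.Theorems.WeightedInvariantWeightedConstructionWeightedChartBasicOpen
import Mathlib.RingTheory.Ideal.KrullsHeightTheorem
import HarnessLib

/-!
# (open″)↾≤2 at a CLOSED-POINT CENTRE: the case-(iii) engine of ORDER (o24-O) (door `HypersurfaceCentreConstruction`,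
# stmt-ResolutionOfSingularities-19897 · rung P2 · conjunct `JOpenPresentationForallSingLE2 p iotaOrd J`; lead res-type-005,
# res-L1-w43-plan-1 ASSIGNMENT 2026-08-27T08:16:45Z)

Topic: `Summits/ResolutionOfSingularities/ResolutionOfSingularities/Theorems`. Helper for the door item
`HypersurfaceCentreConstruction` (stmt-ResolutionOfSingularities-19897, route `WeightedInvariant`). Case (iii) of (o24-O):
a position `𝔪` of Krull dimension `2` at which the centre of the canonical game is the CLOSED POINT (`P = 𝔪 A_𝔪`; for
`(iotaOrd, jContact)` this is the non-monomial type, res-type-073's `IotaOrderStrat.strat_maximalIdeal_of_forall_ne`, p509553)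
and the centre filtration is presented at `A_𝔪` by a positively weighted regular system of parameters (for `jContact`: the
case-B certificate `(x, y_T; 1, b_T)` of ORDER (o24-G), res-type-098, with res-type-092's `weightedMonomialIdeal_eq_jContact`).
This file is the `J`-GENERIC engine turning those two inputs into the literal ∃-body of `JOpenPresentationForallSingLE2` for
`ι = iotaOrd`; the assembly (`…EFT4SDimLETwoOpen.lean`) instantiates it. [OURS · L1 W4.3] Replaces the role of NO printed item;
NOT a statement of the manuscript [claim: Hironaka2017, status: under-review]. AI work, weaker than expert review.

## What is proved (def-free)

* `weightedMonomialIdeal_unit_mul` — multiplying the parameters by units does not change a weighted monomial ideal.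
* `eq_of_le_of_ringKrullDim_le` — primes `𝔪 ≤ 𝔮` of a Noetherian ring with `dim A_𝔪 = d` and `dim A_𝔮 ≤ d` are equal (Mathlib
  heights: `Ideal.eq_of_le_of_height_le`, `IsLocalization.AtPrime.ringKrullDim_eq_height`).
* **`jOpenPresentationForallSingLE2_body_of_strat_maximalIdeal`** — `k₀` perfect, `A` of finite type, `𝔪` a prime with `A_𝔪`
  regular of Krull dimension `2`, `0 ≠ F ∈ 𝔪² A_𝔪`; HYPOTHESES: (strat) for `iotaOrd` at `A_𝔪` with centre the maximal ideal
  («`𝔪` is isolated in its Samuel stratum among generizations») and a presentation `J(A_𝔪)(F) m = weightedMonomialIdeal xy W m`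
  by a system `xy : Fin N → 𝔪 A_𝔪` spanning `𝔪 A_𝔪` with linearly independent cotangent images and positive weights `W`;
  CONCLUSION: the ∃-body of `JOpenPresentationForallSingLE2 p iotaOrd J` at `(A, 𝔪, F)`: `U` = numerators of `xy` (units do not
  matter: `weightedMonomialIdeal_unit_mul`, `LinearIndependent.units_smul`), the stratum iff from `GenericEquimultiplicity.stratumIff_iotaOrd`
  (p515109: `husc` discharged) with (adm) `IotaOrderStrat.adm_maximalIdeal`, the `U`-bridge from res-type-073's
  `StratumIff.stratumIff_forall_mem_of_comap_of_pos` (p513414), and the presentation demanded only at primes `𝔮 ⊇ 𝔪` of `D(h)`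
  with `dim A_𝔮 ≤ 2`, i.e. at `𝔮 = 𝔪` (`eq_of_le_of_ringKrullDim_le`), where it is the hypothesis read through
  `weightedMonomialIdeal_map`.

## References

* V. Cossart, O. Piltant, J. Algebra 320 (2008), proof of Prop. 4.2. [cite: CossartPiltant2008, Prop. 4.2 (proof)]
* H. Matsumura, *Commutative Ring Theory*, §30 Cor. to Thm. 30.5. [Matsumura1987]
-/

noncomputable section

open IsLocalRing Literature.AlgebraicGeometry.Resolution
open Summit.ResolutionOfSingularities.ResolutionOfSingularities.Cruxes.HypersurfaceCentreConstruction.LocalEngine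

set_option linter.dupNamespace false -- mandated namespace of this single-conjunct summit

namespace Summit.ResolutionOfSingularities.ResolutionOfSingularities.Theorems

namespace GenericEquimultiplicity

/-! ## Two small lemmas -/

/-- Multiplying the parameters by UNITS does not change a weighted monomial ideal. [folklore] -/
theorem weightedMonomialIdeal_unit_mul {S : Type} [CommRing S] {N : ℕ} (u : Fin N → S) (c : Fin N → S)
    (hc : ∀ i, IsUnit (c i)) (w : Fin N → ℕ) (n : ℕ) :
    weightedMonomialIdeal (fun i => c i * u i) w n = weightedMonomialIdeal u w n := by
  have key : ∀ α : Fin N → ℕ, (∏ i, (c i * u i) ^ α i) = (∏ i, c i ^ α i) * ∏ i, u i ^ α i := fun α => by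
    rw [← Finset.prod_mul_distrib]
    exact Finset.prod_congr rfl fun i _ => mul_pow _ _ _
  have hunit : ∀ α : Fin N → ℕ, IsUnit (∏ i, c i ^ α i) := fun α =>
    IsUnit.prod_univ_iff.mpr fun i => (hc i).pow _
  apply le_antisymm
  · rw [weightedMonomialIdeal, Ideal.span_le]
    rintro x ⟨α, hα, rfl⟩
    rw [SetLike.mem_coe, key]
    exact Ideal.mul_mem_left _ _ (Ideal.subset_span ⟨α, hα, rfl⟩)
  · rw [weightedMonomialIdeal, Ideal.span_le]
    rintro x ⟨α, hα, rfl⟩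
    rw [SetLike.mem_coe, ← Ideal.unit_mul_mem_iff_mem _ (hunit α), ← key]
    exact Ideal.subset_span ⟨α, hα, rfl⟩

/-- **Primes `𝔪 ≤ 𝔮` with `dim A_𝔪 = d` and `dim A_𝔮 ≤ d` are equal** (`A` Noetherian; heights). [folklore] -/
theorem eq_of_le_of_ringKrullDim_le {A : Type} [CommRing A] [IsNoetherianRing A] {𝔪 𝔮 : Ideal A} [𝔪.IsPrime] [𝔮.IsPrime]
    (hle : 𝔪 ≤ 𝔮) {d : ℕ} (h𝔪 : ringKrullDim (Localization.AtPrime 𝔪) = d)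
    (h𝔮 : ringKrullDim (Localization.AtPrime 𝔮) ≤ d) : 𝔪 = 𝔮 := by
  rw [IsLocalization.AtPrime.ringKrullDim_eq_height 𝔪 (Localization.AtPrime 𝔪)] at h𝔪
  rw [IsLocalization.AtPrime.ringKrullDim_eq_height 𝔮 (Localization.AtPrime 𝔮)] at h𝔮
  refine Ideal.eq_of_le_of_height_le 𝔪 hle ?_
  have h1 : ((𝔮.height : WithBot ℕ∞)) ≤ (𝔪.height : WithBot ℕ∞) := by rw [h𝔪]; exact h𝔮
  exact_mod_cast h1

/-! ## The case-(iii) engine -/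

/-- **(open″)↾≤2 at a closed-point centre, `J`-generic engine.** `k₀` perfect of characteristic `p`, `A` of finite type over
`k₀`, `𝔪` a prime with `A_𝔪` regular of Krull dimension `2`, `0 ≠ F ∈ 𝔪² A_𝔪`. Suppose (strat) holds for `iotaOrd` at `A_𝔪`
with centre the MAXIMAL IDEAL, and `J(A_𝔪)(F)` is presented by a positively weighted system `xy` spanning `𝔪 A_𝔪` with linearly
independent cotangent images: `J (A_𝔪) F m = weightedMonomialIdeal xy W m`. Then the ∃-body of
`JOpenPresentationForallSingLE2 p iotaOrd J` holds at `(A, 𝔪, F)`: `U` = numerators of `xy`, `h` from the stratum iff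
(`stratumIff_iotaOrd`, p515109) and the `U`-bridge (res-type-073, p513414); the presentation is demanded only at the primes
`𝔮 ⊇ 𝔪` of `D(h)` with `dim A_𝔮 ≤ 2`, i.e. at `𝔮 = 𝔪`. [OURS · L1 W4.3 · (o24-O) case (iii)]
[cite: CossartPiltant2008, Prop. 4.2 (proof)] -/
theorem jOpenPresentationForallSingLE2_body_of_strat_maximalIdeal (p : ℕ)
    (J : (R : Type) → [CommRing R] → R → ℕ → Ideal R)
    (k₀ : Type) [Field k₀] [CharP k₀ p] [PerfectField k₀]
    (A : Type) [CommRing A] [Algebra k₀ A] [Algebra.FiniteType k₀ A] (𝔪 : Ideal A) [𝔪.IsPrime] (F : A)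
    (hreg : IsRegularLocalRing (Localization.AtPrime 𝔪)) (hdim : ringKrullDim (Localization.AtPrime 𝔪) = (2 : ℕ))
    (hF0 : algebraMap A (Localization.AtPrime 𝔪) F ≠ 0)
    (hF2 : algebraMap A (Localization.AtPrime 𝔪) F ∈ (maximalIdeal (Localization.AtPrime 𝔪)) ^ 2)
    (hstrat : ∀ (𝔭 : Ideal (Localization.AtPrime 𝔪)) [𝔭.IsPrime],
      algebraMap A (Localization.AtPrime 𝔪) F ∈ 𝔭 →
        (iotaOrd (Localization.AtPrime 𝔭) (algebraMap (Localization.AtPrime 𝔪) (Localization.AtPrime 𝔭)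
            (algebraMap A (Localization.AtPrime 𝔪) F)) =
          iotaOrd (Localization.AtPrime 𝔪) (algebraMap A (Localization.AtPrime 𝔪) F) ↔
            maximalIdeal (Localization.AtPrime 𝔪) ≤ 𝔭))
    {N : ℕ} (xy : Fin N → Localization.AtPrime 𝔪) (W : Fin N → ℕ) (hW : ∀ i, 0 < W i)
    (hxy : ∀ i, xy i ∈ maximalIdeal (Localization.AtPrime 𝔪))
    (hspan : Ideal.span (Set.range xy) = maximalIdeal (Localization.AtPrime 𝔪))
    (hli : LinearIndependent (ResidueField (Localization.AtPrime 𝔪))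
      (fun i => ((maximalIdeal (Localization.AtPrime 𝔪)).toCotangent ⟨xy i, hxy i⟩ :
        CotangentSpace (Localization.AtPrime 𝔪))))
    (hJ : ∀ m : ℕ, J (Localization.AtPrime 𝔪) (algebraMap A (Localization.AtPrime 𝔪) F) m = weightedMonomialIdeal xy W m) :
    ∃ h : A, h ∉ 𝔪 ∧ ∃ (N : ℕ) (U : Fin N → A) (W : Fin N → ℕ), (∀ i, 0 < W i) ∧
      (∃ hU : ∀ i, algebraMap A (Localization.AtPrime 𝔪) (U i) ∈ maximalIdeal (Localization.AtPrime 𝔪),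
        LinearIndependent (ResidueField (Localization.AtPrime 𝔪))
          (fun i => ((maximalIdeal (Localization.AtPrime 𝔪)).toCotangent ⟨_, hU i⟩ :
            CotangentSpace (Localization.AtPrime 𝔪)))) ∧
      ∀ (𝔮 : Ideal A) [𝔮.IsPrime], h ∉ 𝔮 → ringKrullDim (Localization.AtPrime 𝔮) ≤ 2 →
        ((∀ i, U i ∈ 𝔮) ↔
          (algebraMap A (Localization.AtPrime 𝔮) F ∈ (maximalIdeal (Localization.AtPrime 𝔮)) ^ 2 ∧
            iotaOrd (Localization.AtPrime 𝔮) (algebraMap A (Localization.AtPrime 𝔮) F) =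
              iotaOrd (Localization.AtPrime 𝔪) (algebraMap A (Localization.AtPrime 𝔪) F))) ∧
        ((∀ i, U i ∈ 𝔮) → ∀ m : ℕ,
          J (Localization.AtPrime 𝔮) (algebraMap A (Localization.AtPrime 𝔮) F) m =
            (weightedMonomialIdeal U W m).map (algebraMap A (Localization.AtPrime 𝔮))) := by
  classical
  have _unused : CharP k₀ p := inferInstance
  haveI : IsNoetherianRing A := Algebra.FiniteType.isNoetherianRing k₀ A
  haveI := hreg
  -- numerators of the system `xy`
  have hnum : ∀ i, ∃ (a : A) (s : 𝔪.primeCompl), algebraMap A (Localization.AtPrime 𝔪) a = algebraMap A (Localization.AtPrime 𝔪) (s : A) * xy i := fun i => by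
    obtain ⟨⟨a, s⟩, has⟩ := IsLocalization.surj 𝔪.primeCompl (xy i)
    exact ⟨a, s, by rw [← has, mul_comm]⟩
  choose U s hUs using hnum
  have hsu : ∀ i, IsUnit (algebraMap A (Localization.AtPrime 𝔪) (s i : A)) := fun i => IsLocalization.map_units (Localization.AtPrime 𝔪) (s i)
  have hUm : ∀ i, algebraMap A (Localization.AtPrime 𝔪) (U i) ∈ maximalIdeal (Localization.AtPrime 𝔪) := fun i => by
    rw [hUs i]; exact Ideal.mul_mem_left _ _ (hxy i)
  -- same ideals: the span and the weighted monomial ideals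
  have hspanU : Ideal.span (Set.range fun i => algebraMap A (Localization.AtPrime 𝔪) (U i)) = maximalIdeal (Localization.AtPrime 𝔪) := by
    apply le_antisymm
    · rw [Ideal.span_le]
      rintro _ ⟨i, rfl⟩
      exact hUm i
    · rw [← hspan, Ideal.span_le]
      rintro _ ⟨i, rfl⟩
      rw [SetLike.mem_coe, ← Ideal.unit_mul_mem_iff_mem _ (hsu i), ← hUs i]
      exact Ideal.subset_span ⟨i, rfl⟩
  have hmapU : (Ideal.span {x | ∃ i, 0 < W i ∧ x = U i}).map (algebraMap A (Localization.AtPrime 𝔪)) = maximalIdeal (Localization.AtPrime 𝔪) := by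
    rw [← hspanU, Ideal.map_span]
    congr 1
    ext z
    constructor
    · rintro ⟨_, ⟨i, -, rfl⟩, rfl⟩
      exact ⟨i, rfl⟩
    · rintro ⟨i, rfl⟩
      exact ⟨U i, ⟨i, hW i, rfl⟩, rfl⟩
  have hwmi : ∀ m, weightedMonomialIdeal (fun i => algebraMap A (Localization.AtPrime 𝔪) (U i)) W m = weightedMonomialIdeal xy W m := fun m => by
    have : (fun i => algebraMap A (Localization.AtPrime 𝔪) (U i)) = fun i => algebraMap A (Localization.AtPrime 𝔪) (s i : A) * xy i := funext hUs
    rw [this, weightedMonomialIdeal_unit_mul xy _ hsu W m]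
  -- linear independence of the cotangent images of the numerators
  have hliU : LinearIndependent (ResidueField (Localization.AtPrime 𝔪))
      (fun i => ((maximalIdeal (Localization.AtPrime 𝔪)).toCotangent ⟨algebraMap A (Localization.AtPrime 𝔪) (U i), hUm i⟩ :
        CotangentSpace (Localization.AtPrime 𝔪))) := by
    have hne : ∀ i, residue (Localization.AtPrime 𝔪) (algebraMap A (Localization.AtPrime 𝔪) (s i : A)) ≠ 0 := fun i => by
      rw [ne_eq, residue_eq_zero_iff]
      exact fun h => (mem_nonunits_iff.mp ((IsLocalRing.mem_maximalIdeal _).mp h)) (hsu i)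
    have h := hli.units_smul fun i => Units.mk0 _ (hne i)
    convert h using 1
    funext i
    rw [Pi.smul_apply', Units.smul_def, Units.val_mk0, ← ResidueField.algebraMap_eq, algebraMap_smul, ← map_smul]
    congr 1
    apply Subtype.ext
    change algebraMap A (Localization.AtPrime 𝔪) (U i) = _
    rw [Submodule.coe_smul, smul_eq_mul, hUs i]
  -- (adm) for the centre `𝔪 A_𝔪`
  have hadm : ∀ (Q : Ideal (Localization.AtPrime 𝔪)) [Q.IsPrime], maximalIdeal (Localization.AtPrime 𝔪) ≤ Q →
      algebraMap (Localization.AtPrime 𝔪) (Localization.AtPrime Q) (algebraMap A (Localization.AtPrime 𝔪) F) ∈ maximalIdeal (Localization.AtPrime Q) ^ 2 :=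
    fun Q _ hQ => IotaOrderStrat.adm_maximalIdeal hF2 Q hQ
  -- the stratum iff (husc discharged) and the `U`-bridge
  have hiff := stratumIff_iotaOrd k₀ 𝔪 F hreg hF0 (maximalIdeal (Localization.AtPrime 𝔪)) (fun 𝔭 _ hF𝔭 => hstrat 𝔭 hF𝔭) hadm
  obtain ⟨h, hh, hU⟩ := StratumIff.stratumIff_forall_mem_of_comap_of_pos 𝔪 U W hW (maximalIdeal (Localization.AtPrime 𝔪)) hmapU
    (fun x => algebraMap A (Localization.AtPrime x.asIdeal) F ∈ maximalIdeal (Localization.AtPrime x.asIdeal) ^ 2 ∧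
      iotaOrd (Localization.AtPrime x.asIdeal) (algebraMap A (Localization.AtPrime x.asIdeal) F) =
        iotaOrd (Localization.AtPrime 𝔪) (algebraMap A (Localization.AtPrime 𝔪) F)) hiff
  have hcomap : (maximalIdeal (Localization.AtPrime 𝔪)).comap (algebraMap A (Localization.AtPrime 𝔪)) = 𝔪 := Localization.AtPrime.under_maximalIdeal
  -- the bridge `span U ≤ 𝔮 ↔ 𝔪 ≤ 𝔮` on a basic open
  obtain ⟨h₂, hh₂, hbridge⟩ :=
    StratumIff.exists_forall_le_iff_comap_le 𝔪 (Ideal.span {x | ∃ i, 0 < W i ∧ x = U i})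
  refine ⟨h * h₂, fun hmem => (Ideal.IsPrime.mem_or_mem inferInstance hmem).elim hh hh₂, N, U, W, hW, ⟨hUm, hliU⟩,
    fun 𝔮 _ hh𝔮 hdim𝔮 => ?_⟩
  have hh𝔮' : h ∉ 𝔮 := fun h' => hh𝔮 (Ideal.mul_mem_right _ _ h')
  have hh₂𝔮 : h₂ ∉ 𝔮 := fun h' => hh𝔮 (Ideal.mul_mem_left _ _ h')
  refine ⟨hU 𝔮 hh𝔮', fun hU𝔮 m => ?_⟩
  -- `𝔪 ≤ 𝔮`, hence `𝔮 = 𝔪` (heights), where the presentation is the hypothesis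
  have h𝔪𝔮 : 𝔪 ≤ 𝔮 := by
    have h1 : Ideal.span {x | ∃ i, 0 < W i ∧ x = U i} ≤ 𝔮 := by
      rw [Ideal.span_le]
      rintro _ ⟨i, -, rfl⟩
      exact hU𝔮 i
    have h2 := (hbridge 𝔮 hh₂𝔮).mp h1
    rwa [hmapU, hcomap] at h2
  have heq : 𝔪 = 𝔮 := eq_of_le_of_ringKrullDim_le h𝔪𝔮 hdim (by exact_mod_cast hdim𝔮)
  subst heq
  rw [weightedMonomialIdeal_map, hwmi m, hJ m]

end GenericEquimultiplicity

end Summit.ResolutionOfSingularities.ResolutionOfSingularities.Theorems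

end
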